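import Summits.QuantumFields.YangMills.Theorems.BalabanUVNodesN14SharpTiltDefect
import Summits.QuantumFields.YangMills.Theorems.BalabanUVNodesN19CoreTVInvariant

/-!
# DAG node N14 · NE1′ — THE SHARP TILT-DEFECT CONSTANT, CHAIN EDITIONS: SHAPE_cl(`r`) in density form ⇒ N14's binder `TiltedMeanMatching` at the
# sharp rate `2B·tanh(r∕2)` and the LINEAR rate `B·r` (so `∃ η, … ∧ Summable η` from `Summable r` directly); SHAPE_cl(`r`) ⇒ TV_cl at `tanh(r∕2)` (odds ratio)

Cell `pub-ymgap`, YM-PLAN Track A (HUMAN RULING D-0062 ∕ D-0149, director-ym №197), width seat `pub-ymgap-dag-n14-w3` (generation 2); sibling of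
`…N14SharpTiltDefect` (the one-law engine `abs_tiltedMean_tilted_sub_le_tanh`, attained on a two-point law).  N14 is carried DEPENDENT on §N19 s1 ∕ U3
(director-ym №195 (8)); these are the by-name editions, at the sharp constants, of the two N19-side typed sub-lemmas N14's binder runs on: n19-c
`N19ClassSandwichRoad.tiltedMeanMatching_of_shapeDensity` (p496221 §3; rate `B·(e^{2r} − 1)`) and n19-c `N19CoreTVInvariant.tvSandwich_of_shapeSandwich`
(rate `e^{2r} − 1`).  THEOREMS ONLY (0 `def`); imports the sibling and n19-c's `…N19CoreTVInvariant` (through it `…N19TVCurrency.real_sandwich_of_measure_sandwich`,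
`…N19ClassSandwichRoad.tiltedMean_withDensity_exp_eq_tilted`, n14-c `ConvexFibreMatching.tiltedMean_smul_measure`) — cited BY NAME, binder prefixes VERBATIM;
edits nothing; `--supports` K3⁷ `SpineGivenEndpointR13SepCoPH` (stmt-QuantumFields-20544) `--as helper`, COUNT-NEUTRAL.

* §1 [folklore, reals] THE ODDS-RATIO BOUND: `div_self_nonneg'` · `div_add_le_div_add` · `div_sub_div_le_of_oddsRatio` · `abs_div_sub_div_le_of_oddsRatio` ·
  `oddsRatio_bound_attained` (equality at `(1, u) ∕ (u², u)`) — two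
  pairs of masses sandwiched `κ·s ≤ s′ ≤ κu²·s` (a per-class measure sandwich of width `r` read on `S` and on `Sᶜ`: `κ = e^{c−r}`, `u = e^{r}`) have
  normalised masses `(u − 1)∕(u + 1) = tanh(r∕2)`-close (two Bernoulli parameters with odds ratio `≤ u²`; worst case `p = 1∕(1 + u)`); the tree's
  `N19TVCurrency.abs_div_sub_div_le_of_sandwich_pair` reads `S` and `univ` and gets `e^{2r} − 1`.
* §2 [the chain's editions] ★ `tiltedMeanMatching_of_shapeDensity_tanh` (`η K = 2B·tanh(r K∕2)`; the class piece need not be normalised — the engine takes a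
  finite non-zero law) · `tiltedMeanMatching_of_shapeDensity_linear` (`η K = B·r K`, `tanh_le_self`) · `exists_tiltedMeanMatching_summable_of_shapeDensity_linear`
  (the consumed (I)-slot shape `∃ η, TiltedMeanMatching … η ∧ Summable η`, `η := B·r`, `Summable.mul_left` — no `summable_exp_sub_one` detour) ·
  ★ `tvSandwich_of_shapeSandwich_tanh` (`ρ K = tanh(r₂ K∕2)`).
n19-w2's record-keyed faces (`…N19ShapeFaceN14AtRecord` §1–§3) inherit the sharp ∕ linear rates by replacing their last line with these; not re-typed here.

HONEST FRAMING.  Sharp [folklore] inequalities on HYPOTHESIS SHAPES — SHAPE_cl ∕ TV_cl are UNPRINTED two-run statements for d = 4, produced by nobody; ZERO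
estimate content for Bałaban's runs; nothing of Bałaban's instantiated; NE1′ ∕ NE7 NOT PRINTED as two-run statements and NOT PROVED; N14 NOT discharged
(DEPENDENT on §N19 s1 ∕ U3); K3⁷ OPEN, not claimed; counts UNMOVED (typed 28∕28 · discharged 5∕27, A 5∕28).  One finite 𝕋⁴ programme at fixed `ε`; the
Yang–Mills mass gap (Clay) is NOT proved by any of this — R4 closes the conditional finite-𝕋⁴ rung `BalabanLadder.UV` only; NOT ℝ⁴, NOT OS, NOT a mass gap.
0 `def`; 0 `sorry`; standard axioms; no decl below carries a cite tag.
-/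

set_option autoImplicit false

noncomputable section

open MeasureTheory ProbabilityTheory
open scoped ENNReal

namespace YMDAG.N14.SharpTilt

open Summit.QuantumFields.BalabanUV.T4Continuum.NE1p.DressedMGFForm (tiltedMean TiltedMeanMatching)

/-! ## §1 The odds-ratio bound: normalised masses from a two-set sandwich -/

section Reals

/-- A real divided by itself is nonnegative (`1`, or the junk value `0`). [folklore] -/
theorem div_self_nonneg' (X : ℝ) : (0 : ℝ) ≤ X / X := by
  rcases eq_or_ne X 0 with h | h
  · simp [h]
  · rw [div_self h]; exact zero_le_one

/-- Ratio monotonicity: `s ↦ s∕(s + c)` is monotone on `[0, ∞)` for `c ≥ 0` (junk `0∕0 = 0` included). [folklore] -/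
theorem div_add_le_div_add {s X c : ℝ} (hs : 0 ≤ s) (hsX : s ≤ X) (hc : 0 ≤ c) : s / (s + c) ≤ X / (X + c) := by
  rcases eq_or_lt_of_le hc with hc0 | hc0
  · subst hc0
    rcases eq_or_lt_of_le hs with hs0 | hs0
    · subst hs0
      simp only [add_zero, zero_div]
      exact div_self_nonneg' X
    · rw [add_zero, add_zero, div_self hs0.ne', div_self (hs0.trans_le hsX).ne']
  · have h1 : 0 < s + c := by linarith
    have h2 : 0 < X + c := by linarith
    rw [div_le_div_iff₀ h1 h2]
    nlinarith

/-- **THE ODDS-RATIO BOUND** [folklore]: two pairs of nonnegative masses `(sA, sA′)` (run A on `S` and `Sᶜ`) and `(sB, sB′)` sandwiched by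
`κ·sA ≤ sB ≤ κu²·sA`, `κ·sA′ ≤ sB′` (`0 < κ`, `1 ≤ u` — a per-class measure sandwich of width `r` read on `S` and `Sᶜ` has `κ = e^{c−r}`,
`u = e^{r}`) have normalised masses with `sB∕(sB + sB′) − sA∕(sA + sA′) ≤ (u − 1)∕(u + 1)`: the odds ratio is at most `u²`, and two Bernoulli
parameters with odds ratio `≤ u²` differ by at most `(u − 1)∕(u + 1)` (worst case `sA∕(sA + sA′) = 1∕(1 + u)`).  Massless classes read `0`. -/
theorem div_sub_div_le_of_oddsRatio {sA sA' sB sB' κ u : ℝ} (hsA : 0 ≤ sA) (hsA' : 0 ≤ sA') (hκ : 0 < κ) (hu : 1 ≤ u)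
    (hBlo : κ * sA ≤ sB) (hBhi : sB ≤ κ * u ^ 2 * sA) (hB'lo : κ * sA' ≤ sB') :
    sB / (sB + sB') - sA / (sA + sA') ≤ (u - 1) / (u + 1) := by
  have hτ : 0 ≤ (u - 1) / (u + 1) := div_nonneg (by linarith) (by linarith)
  have hsB : 0 ≤ sB := (mul_nonneg hκ.le hsA).trans hBlo
  have hsB' : 0 ≤ sB' := (mul_nonneg hκ.le hsA').trans hB'lo
  have hX : 0 ≤ κ * u ^ 2 * sA := by positivity
  -- step 1: raise `sB` to its ceiling, lower `sB'` to its floor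
  have h1 : sB / (sB + sB') ≤ κ * u ^ 2 * sA / (κ * u ^ 2 * sA + sB') := div_add_le_div_add hsB hBhi hsB'
  have h2 : κ * u ^ 2 * sA / (κ * u ^ 2 * sA + sB') ≤ κ * u ^ 2 * sA / (κ * u ^ 2 * sA + κ * sA') := by
    rcases eq_or_lt_of_le hX with hX0 | hX0
    · rw [← hX0]; simp
    · exact div_le_div_of_nonneg_left hX (by positivity) (by linarith)
  have h3 : κ * u ^ 2 * sA / (κ * u ^ 2 * sA + κ * sA') = u ^ 2 * sA / (u ^ 2 * sA + sA') := by
    rw [show κ * u ^ 2 * sA + κ * sA' = κ * (u ^ 2 * sA + sA') by ring, mul_assoc,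
      mul_div_mul_left _ _ hκ.ne']
  -- step 2: the one-parameter inequality
  have h4 : u ^ 2 * sA / (u ^ 2 * sA + sA') - sA / (sA + sA') ≤ (u - 1) / (u + 1) := by
    rcases eq_or_lt_of_le (add_nonneg hsA hsA') with hm | hm
    · have hsA0 : sA = 0 := by linarith
      have hsA'0 : sA' = 0 := by linarith
      subst hsA0; subst hsA'0
      simpa using hτ
    · have hd1 : 0 < u ^ 2 * sA + sA' := by nlinarith
      have hu1 : 0 < u + 1 := by linarith
      rw [div_sub_div _ _ hd1.ne' hm.ne', div_le_div_iff₀ (mul_pos hd1 hm) hu1]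
      nlinarith [mul_nonneg (sub_nonneg.mpr hu) (sq_nonneg (u * sA - sA')), mul_nonneg hsA hsA',
        mul_nonneg (mul_nonneg hsA hsA') hu1.le]
  linarith [h1, h2, h3.le, h3.ge, h4]

/-- **… TWO-SIDED** [folklore]: with BOTH pairs fully sandwiched (`κ·s ≤ s′ ≤ κu²·s` on `S` and on `Sᶜ`) the normalised masses are
`(u − 1)∕(u + 1)`-close in absolute value (the complement swaps the roles: `sA∕(sA + sA′) = 1 − sA′∕(sA′ + sA)`). -/
theorem abs_div_sub_div_le_of_oddsRatio {sA sA' sB sB' κ u : ℝ} (hsA : 0 ≤ sA) (hsA' : 0 ≤ sA') (hκ : 0 < κ) (hu : 1 ≤ u)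
    (hBlo : κ * sA ≤ sB) (hBhi : sB ≤ κ * u ^ 2 * sA) (hB'lo : κ * sA' ≤ sB') (hB'hi : sB' ≤ κ * u ^ 2 * sA') :
    |sB / (sB + sB') - sA / (sA + sA')| ≤ (u - 1) / (u + 1) := by
  refine abs_sub_le_iff.2 ⟨div_sub_div_le_of_oddsRatio hsA hsA' hκ hu hBlo hBhi hB'lo, ?_⟩
  have hτ : 0 ≤ (u - 1) / (u + 1) := div_nonneg (by linarith) (by linarith)
  rcases eq_or_lt_of_le (add_nonneg hsA hsA') with hm | hm
  · have hsA0 : sA = 0 := by linarith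
    have hsA'0 : sA' = 0 := by linarith
    have hsB0 : sB = 0 := le_antisymm (by rw [hsA0, mul_zero] at hBhi; exact hBhi) (by rw [hsA0, mul_zero] at hBlo; exact hBlo)
    rw [hsA0, hsB0]
    simpa using hτ
  · have hmB : 0 < sB + sB' := by nlinarith [mul_pos hκ hm]
    have e1 : sA / (sA + sA') = 1 - sA' / (sA' + sA) := by
      rw [add_comm sA' sA, eq_sub_iff_add_eq, ← add_div, div_self hm.ne']
    have e2 : sB / (sB + sB') = 1 - sB' / (sB' + sB) := by
      rw [add_comm sB' sB, eq_sub_iff_add_eq, ← add_div, div_self hmB.ne']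
    rw [e1, e2]
    have := div_sub_div_le_of_oddsRatio hsA' hsA hκ hu hB'lo hB'hi hBlo
    linarith


/-- **THE ODDS-RATIO BOUND IS ATTAINED** [decided witness]: masses `(sA, sA′) = (1, u)` and `(sB, sB′) = (u², u)` (`κ = 1`) meet the sandwich and give
`sB∕(sB + sB′) − sA∕(sA + sA′) = u∕(u + 1) − 1∕(1 + u) = (u − 1)∕(u + 1)` — so `tanh(r∕2)` in `tvSandwich_of_shapeSandwich_tanh` cannot be lowered. -/
theorem oddsRatio_bound_attained {u : ℝ} (hu : 0 < u) :
    u ^ 2 / (u ^ 2 + u) - 1 / (1 + u) = (u - 1) / (u + 1) := by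
  have h1 : u ^ 2 + u = u * (u + 1) := by ring
  have hu1 : u + 1 ≠ 0 := by positivity
  rw [h1, add_comm 1 u]
  field_simp

end Reals

/-! ## §2 The chain's editions: SHAPE_cl ⇒ N14's binder at the sharp ∕ linear rate, SHAPE_cl ⇒ TV_cl at `tanh(r∕2)` -/

section Chain

variable {ι : Type*} [DecidableEq ι] {Ω : ℕ → Type*} [∀ K, MeasurableSpace (Ω K)]
  {l₀ B : ℝ} {T : ℕ → Finset ι} {Bad : ℕ → ℝ → Finset ι} {W : ∀ K, Ω K → ℝ}
  {μA μB : ∀ K, ι → Measure (Ω K)} {r r₂ : ℕ → ℝ}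

/-- ★ **SHAPE_cl IN DENSITY FORM ⇒ N14's BINDER AT THE SHARP RATE** [folklore]: n19-c's `N19ClassSandwichRoad.tiltedMeanMatching_of_shapeDensity`
with its binder prefix VERBATIM and the conclusion `TiltedMeanMatching l₀ T Bad W μA W μB (K ↦ 2B·tanh(r K∕2))` in place of `(K ↦ B·(e^{2 r K} − 1))`
(`abs_tiltedMean_tilted_sub_le_tanh`; the class piece need not be normalised — the lemma takes a finite non-zero law). -/
theorem tiltedMeanMatching_of_shapeDensity_tanh
    (hD : ∀ (K : ℕ) (t : ℝ), |t| ≤ l₀ → ∀ τ ∈ T K \ Bad K t, ∃ (c : ℝ) (g : Ω K → ℝ), Measurable g ∧ (∀ ω, |g ω| ≤ r K) ∧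
      μB K τ = ENNReal.ofReal (Real.exp c) • (μA K τ).withDensity fun ω => ENNReal.ofReal (Real.exp (g ω)))
    (hr : ∀ K, 0 ≤ r K) (hB : 0 ≤ B) (hfin : ∀ K, ∀ τ ∈ T K, IsFiniteMeasure (μA K τ)) (hWm : ∀ K, Measurable (W K))
    (hWb : ∀ K ω, |W K ω| ≤ B) :
    TiltedMeanMatching l₀ T Bad W μA W μB fun K => 2 * B * Real.tanh (r K / 2) := by
  intro K t ht τ hτ s _
  have hτT : τ ∈ T K := (Finset.mem_sdiff.mp hτ).1
  haveI := hfin K τ hτT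
  obtain ⟨c, g, hgm, hgb, hμB⟩ := hD K t ht τ hτ
  have hrhs : 0 ≤ 2 * B * Real.tanh (r K / 2) := by
    have := tanh_half_nonneg (hr K); positivity
  rcases eq_zero_or_neZero (μA K τ) with h0 | hne
  · have hB0 : μB K τ = 0 := by rw [hμB, h0, withDensity_zero_left, smul_zero]
    simpa [tiltedMean, h0, hB0] using hrhs
  · have hc0 : (ENNReal.ofReal (Real.exp c)) ≠ 0 := (ENNReal.ofReal_pos.2 (Real.exp_pos c)).ne'
    have hBt : tiltedMean (W K) (μB K τ) s = tiltedMean (W K) ((μA K τ).tilted g) s := by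
      rw [hμB, YMDAG.N14.ConvexFibreMatching.tiltedMean_smul_measure _ _ hc0 ENNReal.ofReal_ne_top,
        Summit.QuantumFields.YangMills.BalabanUVNodes.N19ClassSandwichRoad.tiltedMean_withDensity_exp_eq_tilted (μA K τ) hgm hgb]
    rw [hBt]
    exact abs_tiltedMean_tilted_sub_le_tanh hgm hgb (hWm K) (hWb K) s

/-- **… AT THE LINEAR RATE** `η K = B·r K` [folklore] (`abs_tiltedMean_tilted_sub_le_linear`) — so `Summable r ⇒ Summable η` with no
`e^{2r} − 1` detour (`exists_tiltedMeanMatching_summable_of_shapeDensity_linear`). -/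
theorem tiltedMeanMatching_of_shapeDensity_linear
    (hD : ∀ (K : ℕ) (t : ℝ), |t| ≤ l₀ → ∀ τ ∈ T K \ Bad K t, ∃ (c : ℝ) (g : Ω K → ℝ), Measurable g ∧ (∀ ω, |g ω| ≤ r K) ∧
      μB K τ = ENNReal.ofReal (Real.exp c) • (μA K τ).withDensity fun ω => ENNReal.ofReal (Real.exp (g ω)))
    (hr : ∀ K, 0 ≤ r K) (hB : 0 ≤ B) (hfin : ∀ K, ∀ τ ∈ T K, IsFiniteMeasure (μA K τ)) (hWm : ∀ K, Measurable (W K))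
    (hWb : ∀ K ω, |W K ω| ≤ B) :
    TiltedMeanMatching l₀ T Bad W μA W μB fun K => B * r K := by
  intro K t ht τ hτ s hs
  have ht2 : Real.tanh (r K / 2) ≤ r K / 2 := Literature.Barriers.HubbardSuperconductivity.tanh_le_self (by linarith [hr K])
  calc |tiltedMean (W K) (μB K τ) s - tiltedMean (W K) (μA K τ) s| ≤ 2 * B * Real.tanh (r K / 2) :=
        tiltedMeanMatching_of_shapeDensity_tanh hD hr hB hfin hWm hWb K t ht τ hτ s hs
    _ ≤ 2 * B * (r K / 2) := mul_le_mul_of_nonneg_left ht2 (by positivity)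
    _ = B * r K := by ring

/-- **THE (I)-SLOT SHAPE `∃ η, TiltedMeanMatching … η ∧ Summable η`** from SHAPE_cl in density form with summable widths — the N14 face of leaf D's
keyed tower edge in its consumed form (n19-w2's `exists_tiltedMeanMatching_summable_of_shapeDensity_map₂` shape, one space), `η := B·r`. [folklore] -/
theorem exists_tiltedMeanMatching_summable_of_shapeDensity_linear
    (hD : ∀ (K : ℕ) (t : ℝ), |t| ≤ l₀ → ∀ τ ∈ T K \ Bad K t, ∃ (c : ℝ) (g : Ω K → ℝ), Measurable g ∧ (∀ ω, |g ω| ≤ r K) ∧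
      μB K τ = ENNReal.ofReal (Real.exp c) • (μA K τ).withDensity fun ω => ENNReal.ofReal (Real.exp (g ω)))
    (hr : ∀ K, 0 ≤ r K) (hrs : Summable r) (hB : 0 ≤ B) (hfin : ∀ K, ∀ τ ∈ T K, IsFiniteMeasure (μA K τ))
    (hWm : ∀ K, Measurable (W K)) (hWb : ∀ K ω, |W K ω| ≤ B) :
    ∃ η : ℕ → ℝ, TiltedMeanMatching l₀ T Bad W μA W μB η ∧ Summable η :=
  ⟨fun K => B * r K, tiltedMeanMatching_of_shapeDensity_linear hD hr hB hfin hWm hWb, hrs.mul_left B⟩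

/-- ★ **SHAPE_cl ⇒ TV_cl AT `tanh(r∕2)`** [folklore]: n19-c's `N19CoreTVInvariant.tvSandwich_of_shapeSandwich` with its binder prefix VERBATIM and the
conclusion `≤ tanh(r₂ K∕2)` in place of `≤ e^{2 r₂ K} − 1`: the per-class measure sandwich read on `S` AND `Sᶜ` (n19-c `real_sandwich_of_measure_sandwich`)
bounds the odds ratio of the normalised masses by `e^{2 r₂ K}` (`abs_div_sub_div_le_of_oddsRatio`, `κ = e^{c − r}`, `u = e^{r}`). -/
theorem tvSandwich_of_shapeSandwich_tanh (hfinA : ∀ K, ∀ τ ∈ T K, IsFiniteMeasure (μA K τ)) (hr : ∀ K, 0 ≤ r₂ K)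
    (hSh : ∀ (K : ℕ) (t : ℝ), |t| ≤ l₀ → ∀ τ ∈ T K \ Bad K t, ∃ c : ℝ,
      ENNReal.ofReal (Real.exp (c - r₂ K)) • μA K τ ≤ μB K τ ∧ μB K τ ≤ ENNReal.ofReal (Real.exp (c + r₂ K)) • μA K τ) :
    ∀ (K : ℕ) (t : ℝ), |t| ≤ l₀ → ∀ τ ∈ T K \ Bad K t, ∀ S : Set (Ω K), MeasurableSet S →
      |(μB K τ).real S / (μB K τ).real Set.univ - (μA K τ).real S / (μA K τ).real Set.univ| ≤ Real.tanh (r₂ K / 2) := by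
  intro K t ht τ hτ S hS
  have hτT : τ ∈ T K := (Finset.mem_sdiff.mp hτ).1
  haveI := hfinA K τ hτT
  obtain ⟨c, hlo, hhi⟩ := hSh K t ht τ hτ
  haveI : IsFiniteMeasure (μB K τ) := ⟨lt_of_le_of_lt (Measure.le_iff'.1 hhi Set.univ) (by
    rw [Measure.smul_apply, smul_eq_mul]; exact ENNReal.mul_lt_top ENNReal.ofReal_lt_top (measure_lt_top _ _))⟩
  have hs := Summit.QuantumFields.YangMills.BalabanUVNodes.N19TVCurrency.real_sandwich_of_measure_sandwich
    (Real.exp_pos _).le (Real.exp_pos _).le hlo hhi S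
  have hs' := Summit.QuantumFields.YangMills.BalabanUVNodes.N19TVCurrency.real_sandwich_of_measure_sandwich
    (Real.exp_pos _).le (Real.exp_pos _).le hlo hhi Sᶜ
  have hκu : Real.exp (c - r₂ K) * Real.exp (r₂ K) ^ 2 = Real.exp (c + r₂ K) := by
    rw [sq, ← Real.exp_add, ← Real.exp_add]; congr 1; ring
  rw [← measureReal_add_measureReal_compl (μ := μB K τ) hS, ← measureReal_add_measureReal_compl (μ := μA K τ) hS, tanh_half_eq_exp]
  exact abs_div_sub_div_le_of_oddsRatio measureReal_nonneg measureReal_nonneg (Real.exp_pos _) (Real.one_le_exp (hr K)) hs.1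
    (by rw [hκu]; exact hs.2) hs'.1 (by rw [hκu]; exact hs'.2)

end Chain

end YMDAG.N14.SharpTilt

end
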